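import Summits.CriticalPhenomena.Ising3D.TaylorCertificateOddCone
import Summits.CriticalPhenomena.Ising3D.TaylorCertificateRegion
import Mathlib.Tactic.Linarith
import Mathlib.Tactic.Positivity
import Mathlib.Tactic.Ring
import HarnessLib

/-!
# The obligation list of a derivative certificate WITH THE ODD CONE, and `BoxExcluded` from it
(cell `pub-ising3x`, seat recog-1 gen 10; the normative Lean statement of obligation (D5b) of
HOME/pub-ising3x-boot-1/OBLIGATIONS-pmp1-deriv-rc0-DRAFT.md — the structure the rational TABLE theorem
(g2) is to discharge for the odd sector; even-sector and identity fields are those of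
`TaylorTermwiseObligations` verbatim)

HONEST FRAMING: lottery ticket; floor = tightest certified 3D Ising CFT bounds; no exact-solution
claim without a proof.

`TaylorConeObligations α Ψ κ₀ Q E₀ E_T` (a `Prop` structure) for a crossing functional `α⃗`, a majorant
functional `Ψ`, a weight `κ₀`, a set `Q` of external dimensions, an even head threshold `E₀` and an
odd head threshold `E_T`: (I) identity positive on `Q`; (E) even cells below `E₀` (head set + PSD tail
terms) and (E5) the even cone region `TaylorEvenRegion α Q E₀` — exactly as in
`TaylorTermwiseObligations`; (D) for every odd-sector cell strictly above the bound and below `E_T`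
(scalars below 3 only at `Δσ`) a head set `F` with `0 ≤ Σ_{q∈F} oddConeHeadValue` and the cone
condition `OddConeAt` at the descendant terms off `F`; (D5b) the odd cone: `OddConeAt` at every
`(E, j)` with `E ≥ E_T`, `j ≤ E` (integer `j`). THEOREMS: `TaylorConeObligations.oddPositive` (every
odd `(Δ, ℓ)` allowed by A1/A4 is `OddPositive` — head cells by `oddPositive_of_isTaylorAt_of_cone_of_lt`,
tail blocks by the cone, the bound itself vacuous), `isPositiveAt_of_taylorConeObligations` and
`boxExcluded_of_taylorConeObligations` (for `α` Taylor at a diagonal `(x,x)`, `Ψ` Taylor at `(x,x)`,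
`κ₀ > 0`, `E₀ > 1/2`, `Q ⊆ {½ < Δσ < 1, Δε > Δσ + ½}`; no constraint on `E_T`). No dominated odd tail
and no L-odd-tail asymptotics are needed: this closes gate (g1) of M3-γ at the level of typed
obligations (the TABLE layer — interval evaluation of the closed forms over cells and cone boxes — is
the next layer down). Sources: Kos–Poland–Simmons-Duffin 2014 §3.3 eq. (3.16); Dolan–Osborn 2004 §3.
-/

namespace Summit.CriticalPhenomena.Ising3D

open Finset Set
open Literature.MathematicalPhysics.QuantumFieldTheory.ConformalBootstrap3D

/-- **Obligations of a derivative (`Taylor`) certificate with the odd CONE** for `α⃗`, majorant `Ψ`,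
weight `κ₀`, external set `Q`, even threshold `E₀`, odd threshold `E_T`.
[cite: KosPolandSimmonsduffin2014, §3.3 eq. (3.16)] -/
structure TaylorConeObligations (α : CrossingFunctional) (Ψ : (ℝ → ℝ → ℝ) →ₗ[ℝ] ℝ) (κ₀ : ℝ)
    (Q : Set (ℝ × ℝ)) (E₀ E_T : ℝ) : Prop where
  /-- (I) the identity term is positive on `Q`. -/
  identity_pos : ∀ p ∈ Q, 0 < α.identityTerm p.1 p.2
  /-- (E) even-sector cells below `E₀`: head set + PSD tail terms. -/
  even_cell : ∀ p ∈ Q, ∀ (ℓ : ℕ) (Δ : ℝ), Even ℓ → IsAdmissible3D Δ ℓ → Δ < E₀ →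
    (ℓ = 0 → Δ < 3 → Δ = p.2) →
    ∃ F : Finset (ℕ × ℕ),
      (∀ a b : ℝ, 0 ≤ ∑ q ∈ F, hrCoeff Δ ℓ q.1 q.2 / legendreLam ℓ *
        α.evenForm p.1 p.2 (zMono (Δ + (q.1 : ℝ)) q.2) a b) ∧
      (∀ q : ℕ × ℕ, q ∉ F → InDescendantRange ℓ q.1 q.2 →
        ∀ a b : ℝ, 0 ≤ α.evenForm p.1 p.2 (zMono (Δ + (q.1 : ℝ)) q.2) a b)
  /-- (E5) the even tail: the coefficient-free cone region. -/
  even_region : TaylorEvenRegion α Q E₀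
  /-- (D) odd-sector cells strictly above the bound and below `E_T`: corrected head + cone off `F`. -/
  odd_cell : ∀ p ∈ Q, ∀ (ℓ : ℕ) (Δ : ℝ), unitarityBound3D ℓ < Δ → Δ < E_T →
    (ℓ = 0 → Δ < 3 → Δ = p.1) →
    ∃ F : Finset (ℕ × ℕ), 0 ≤ ∑ q ∈ F, oddConeHeadValue α Ψ κ₀ p.1 p.2 Δ ℓ q ∧
      ∀ q : ℕ × ℕ, q ∉ F → InDescendantRange ℓ q.1 q.2 →
        OddConeAt α Ψ κ₀ p.1 p.2 (Δ + (q.1 : ℝ)) q.2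
  /-- (D5b) the odd cone: (M) and (R) at every `(E, j)` with `E ≥ E_T`, `j ≤ E`. -/
  odd_cone : ∀ p ∈ Q, ∀ (E : ℝ) (j : ℕ), E_T ≤ E → (j : ℝ) ≤ E → OddConeAt α Ψ κ₀ p.1 p.2 E j

namespace TaylorConeObligations

variable {α : CrossingFunctional} {Ψ : (ℝ → ℝ → ℝ) →ₗ[ℝ] ℝ} {κ₀ : ℝ} {Q : Set (ℝ × ℝ)}
  {E₀ E_T : ℝ}

/-- **Every odd-sector obligation of `IsPositiveAt` from the cone obligations**: for `α⃗` Taylor at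
`(x,x)`, `Ψ` Taylor at `(x,x)`, `κ₀ > 0`, `Q ⊆ {½ < Δσ < 1, Δε > Δσ + ½}`, every `(Δ, ℓ)` with
`Δ ≥ unitarityBound3D ℓ` and the A4 gap condition is `OddPositive`.
[cite: KosPolandSimmonsduffin2014, §3.3 eq. (3.16)] -/
theorem oddPositive {x : ℝ} (hx0 : 0 < x) (hx1 : x < 1) (hα : IsTaylorAt α x x)
    (hΨ : IsTaylorFunctional x x Ψ) (hκ₀ : 0 < κ₀)
    (hQ : ∀ p ∈ Q, 1 / 2 < p.1 ∧ p.1 < 1 ∧ p.1 + 1 / 2 < p.2)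
    (h : TaylorConeObligations α Ψ κ₀ Q E₀ E_T) :
    ∀ p ∈ Q, ∀ (ℓ : ℕ) (Δ : ℝ), unitarityBound3D ℓ ≤ Δ → (ℓ = 0 → Δ < 3 → Δ = p.1) →
      α.OddPositive p.1 p.2 Δ ℓ := by
  intro p hp ℓ Δ hb hgap
  obtain ⟨h1q, h2q, h3q⟩ := hQ p hp
  have hb0 : unitarityBound3D 0 = 1 / 2 := by simp [unitarityBound3D]
  rcases hb.lt_or_eq with hlt | heq
  · -- strictly above the bound
    have h1 : ℓ = 0 → Δ ≠ 1 := by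
      intro hℓ hΔ
      have := hgap hℓ (by rw [hΔ]; norm_num)
      rw [hΔ] at this
      linarith
    by_cases hE : Δ < E_T
    · obtain ⟨F, hhead, htail⟩ := h.odd_cell p hp ℓ Δ hlt hE hgap
      exact oddPositive_of_isTaylorAt_of_cone_of_lt hx0 hx1 α hα hΨ hκ₀ hlt h1 F hhead htail
    · rw [not_lt] at hE
      have hℓΔ : (ℓ : ℝ) ≤ Δ := (natCast_le_unitarityBound3D ℓ).trans hb
      refine oddPositive_of_isTaylorAt_of_cone_tail hx0 hx1 α hα hΨ hκ₀ hlt h1 fun q hq => ?_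
      have hE' : E_T ≤ Δ + (q.1 : ℝ) := by
        have : (0 : ℝ) ≤ q.1 := Nat.cast_nonneg _
        linarith
      have hj : (q.2 : ℝ) ≤ Δ + (q.1 : ℝ) := by
        have h2 : q.2 ≤ ℓ + q.1 := hq.2.1
        have : (q.2 : ℝ) ≤ ℓ + q.1 := by exact_mod_cast h2
        linarith
      exact h.odd_cone p hp (Δ + (q.1 : ℝ)) q.2 hE' hj
  · -- exactly at the bound: `ℓ = 0` is excluded by the gap (`Δσ > 1/2`), `ℓ ≥ 1` is vacuous
    rcases Nat.eq_zero_or_pos ℓ with hℓ | hℓ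
    · subst hℓ
      rw [hb0] at heq
      have := hgap rfl (by rw [← heq]; norm_num)
      rw [← heq] at this
      linarith
    · have hb' : unitarityBound3D ℓ = (ℓ : ℝ) + 1 := by
        unfold unitarityBound3D; rw [if_neg (by omega)]
      rw [← heq, hb']
      exact oddPositive_bound_of_ne α (by linarith) hℓ

/-- **Every even-sector obligation of `IsPositiveAt` from the even fields** (head cells below `E₀`,
the cone region from `E₀` on; `E₀ > 1/2`). [cite: KosPolandSimmonsduffin2014, §3.3 eq. (3.16)] -/
theorem evenPositive {x : ℝ} (hx0 : 0 < x) (hx1 : x < 1) (hα : IsTaylorAt α x x)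
    (hE₀ : 1 / 2 < E₀) (hQ : ∀ p ∈ Q, 1 / 2 < p.1 ∧ p.1 < 1 ∧ p.1 + 1 / 2 < p.2)
    (h : TaylorConeObligations α Ψ κ₀ Q E₀ E_T) :
    ∀ p ∈ Q, ∀ (ℓ : ℕ) (Δ : ℝ), Even ℓ → unitarityBound3D ℓ ≤ Δ → (ℓ = 0 → Δ < 3 → Δ = p.2) →
      α.EvenPositive p.1 p.2 Δ ℓ := by
  intro p hp ℓ Δ hev hb hgap
  obtain ⟨h1q, _, h3q⟩ := hQ p hp
  by_cases hE : Δ < E₀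
  · have hadm : IsAdmissible3D Δ ℓ := by
      refine ⟨hb, fun hℓ => ?_⟩
      subst hℓ
      have hb0 : unitarityBound3D 0 = 1 / 2 := by simp [unitarityBound3D]
      rw [hb0] at hb ⊢
      rcases hb.lt_or_eq with hlt | heq
      · exact hlt
      · have := hgap rfl (by rw [← heq]; norm_num)
        rw [← heq] at this
        linarith
    obtain ⟨F, hhead, htail⟩ := h.even_cell p hp ℓ Δ hev hadm hE hgap
    exact evenPositive_of_isTaylorAt_of_termwise hx0 hx1 α hα hadm F hhead htail
  · rw [not_lt] at hE
    exact tail_even_of_taylorEvenRegion hx0 hx1 α hα hE₀ h.even_region p hp ℓ hev Δ hb hE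

end TaylorConeObligations

/-- **The cone obligations give `IsPositiveAt` at every point of `Q`.**
[cite: KosPolandSimmonsduffin2014, §3.3 eq. (3.16)] -/
theorem isPositiveAt_of_taylorConeObligations {x : ℝ} (hx0 : 0 < x) (hx1 : x < 1)
    (α : CrossingFunctional) (hα : IsTaylorAt α x x) {Ψ : (ℝ → ℝ → ℝ) →ₗ[ℝ] ℝ}
    (hΨ : IsTaylorFunctional x x Ψ) {κ₀ : ℝ} (hκ₀ : 0 < κ₀) {Q : Set (ℝ × ℝ)} {E₀ E_T : ℝ}
    (hE₀ : 1 / 2 < E₀) (hQ : ∀ p ∈ Q, 1 / 2 < p.1 ∧ p.1 < 1 ∧ p.1 + 1 / 2 < p.2)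
    (h : TaylorConeObligations α Ψ κ₀ Q E₀ E_T) : ∀ p ∈ Q, α.IsPositiveAt p.1 p.2 := by
  intro p hp
  refine ⟨h.identity_pos p hp, ?_, ?_⟩
  · intro Δ ℓ g hev hb hgap hg a b
    exact h.evenPositive hx0 hx1 hα hE₀ hQ p hp ℓ Δ hev hb hgap g hg a b
  · intro Δ ℓ g₁ g₂ hb hgap hg₁ hg₂
    exact h.oddPositive hx0 hx1 hα hΨ hκ₀ hQ p hp ℓ Δ hb hgap g₁ g₂ hg₁ hg₂

/-- **Box exclusion from the cone obligations of a derivative certificate** (T4-A for Taylor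
functionals, `boxExcluded_of_taylorCrossing_of_gap`). [cite: KosPolandSimmonsduffin2014, §3.3 eq. (3.16)] -/
theorem boxExcluded_of_taylorConeObligations {x : ℝ} (hx0 : 0 < x) (hx1 : x < 1)
    (α : CrossingFunctional) (hα : IsTaylorAt α x x) {Ψ : (ℝ → ℝ → ℝ) →ₗ[ℝ] ℝ}
    (hΨ : IsTaylorFunctional x x Ψ) {κ₀ : ℝ} (hκ₀ : 0 < κ₀) {Q : Set (ℝ × ℝ)} {E₀ E_T : ℝ}
    (hE₀ : 1 / 2 < E₀) (hQ : ∀ p ∈ Q, 1 / 2 < p.1 ∧ p.1 < 1 ∧ p.1 + 1 / 2 < p.2)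
    (h : TaylorConeObligations α Ψ κ₀ Q E₀ E_T) : BoxExcluded Q :=
  boxExcluded_of_taylorCrossing_of_gap Q hx0 hx1 α hα (fun p hp => ⟨(hQ p hp).2.1, (hQ p hp).2.2⟩)
    (isPositiveAt_of_taylorConeObligations hx0 hx1 α hα hΨ hκ₀ hE₀ hQ h)

/-- **Specialisation to a concrete derivative certificate at `(½,½)`**: weights `w` on an index set `S`
for `α⃗ = taylorCrossing ½ ½ S w` and majorant weights `ψ` on `Sψ` for `Ψ = Σ ψ(a,b) · taylorCoeffAt ½ ½ (a,b)`.
[cite: KosPolandSimmonsduffin2014, §3.3 eq. (3.17)] -/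
theorem boxExcluded_of_taylorConeObligations_half (S : Finset (ℕ × ℕ)) (w : Fin 5 → ℕ × ℕ → ℝ)
    (Sψ : Finset (ℕ × ℕ)) (ψ : ℕ × ℕ → ℝ) {κ₀ : ℝ} (hκ₀ : 0 < κ₀) {Q : Set (ℝ × ℝ)} {E₀ E_T : ℝ}
    (hE₀ : 1 / 2 < E₀) (hQ : ∀ p ∈ Q, 1 / 2 < p.1 ∧ p.1 < 1 ∧ p.1 + 1 / 2 < p.2)
    (h : TaylorConeObligations (taylorCrossing (1 / 2) (1 / 2) S w)
      (∑ p ∈ Sψ, ψ p • taylorCoeffAt (1 / 2) (1 / 2) p) κ₀ Q E₀ E_T) : BoxExcluded Q :=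
  boxExcluded_of_taylorConeObligations (by norm_num) (by norm_num) _
    (isTaylorAt_taylorCrossing (1 / 2) (1 / 2) S w) ⟨Sψ, ψ, rfl⟩ hκ₀ hE₀ hQ h

end Summit.CriticalPhenomena.Ising3D
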